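import Mathlib
import Summits.Schanuel.Schanuel.Theorems.RigidCoreMinimalCounterexampleInAclHitSetBoxArithComplex
import Summits.Schanuel.Schanuel.Theorems.RigidCoreMinimalCounterexampleInAclHitSetRecursion

/-!
# The complex exponential at Gaussian rationals is a ring-definable family (Taylor enclosures in first-order arithmetic)
# (crux stmt-Schanuel-0969 `RigidCore.MinimalCounterexampleInAcl`, line kernel-arithmetic-selection, stub S8‴)

`--supports stmt-Schanuel-0969`; foundation layer under `stub_corankOne_hitSetRingDefinable` (S8‴).  THE ONE TRANSCENDENTAL INPUT
of the arithmetisation of the hit pattern: the family `(a, b, c) ↦ exp((a + bi)/c)` has ring-definable real and imaginary parts,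
i.e. `{(a, b, c, p, r) : 0 < r ∧ p/r < Re exp((a+bi)/c)} ⊆ ℤ⁵` (and `Im`) is `∅`-definable in the ring `ℤ`
(`ringDefinable_reCut_cexp_gaussRat`, registered helper; `defC_cexp_testPoint`; "ring-definable family" in the sense of
`…HitSetBoxArith.lean`: the strict lower rational cut is written out in every statement).  Proof:

* the Taylor partial sums `S_n(q) = Σ_{k<n} q^k/k!` at `q = (a+bi)/c` are EXACT Gaussian rationals `T_n / D_n` computed by the
  integer recursion `P_{n+1} = (a+bi) P_n`, `T_{n+1} = (n+1) c (T_n + P_n)`, `D_{n+1} = (n+1) c D_n` on `ℤ⁵`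
  (`taylor_invariant`: `P_n = (a+bi)^n`, `D_n = n! cⁿ`, `T_n = D_n S_n(q)`), hence ring-definable functions of `(a, b, c, n)` by
  RING-DEFINABLE PRIMITIVE RECURSION (`ringDefinableMap_natRec`, …HitSetRecursion.lean);
* `S_n(q) → exp q` (`NormedSpace.expSeries_div_hasSum_exp`), and a pointwise LIMIT of a ring-definable family is ring-definable
  (`defR_limit`, …HitSetBoxArith.lean) — no remainder estimate is needed.

Also: `defR_piecewise` (gluing ring-definable families along a ring-definable partition).

References: K. Weihrauch, *Computable Analysis* (2000), Thm 4.3.2 (computability of `exp`); here only arithmetical definability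
is extracted, which is weaker and cheaper.
-/

-- the summit namespace `Summit.Schanuel.Schanuel.…` repeats a component by design (D-0022)
set_option linter.dupNamespace false

open Set FirstOrder FirstOrder.Language Filter Topology

namespace Summit.Schanuel.Schanuel.Cruxes.MinimalCounterexampleInAcl.KernelArithmeticSelection

open Literature.ModelTheory.ExponentialFields

/-! ## The Taylor recursion for `exp` at a Gaussian rational -/

/-- **Invariants of the Taylor recursion.**  For the `ℤ⁵`-valued recursion with `seq 0 = (1, 0, 0, 0, 1)` and step
`(y₀, …, y₄) ↦ (a y₀ − b y₁, a y₁ + b y₀, (n+1) c (y₂ + y₀), (n+1) c (y₃ + y₁), (n+1) c y₄)`: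
`y₀ + y₁ i = (a + bi)ⁿ`, `y₄ = n! cⁿ`, and for `c ≠ 0`, `y₂ + y₃ i = n! cⁿ · Σ_{k<n} ((a+bi)/c)^k / k!`. [folklore] -/
theorem taylor_invariant (a b c : ℤ) (seq : ℕ → Fin 5 → ℤ) (h0 : seq 0 = ![1, 0, 0, 0, 1])
    (hS : ∀ n, seq (n + 1) = ![a * seq n 0 - b * seq n 1, a * seq n 1 + b * seq n 0,
      (n + 1) * c * (seq n 2 + seq n 0), (n + 1) * c * (seq n 3 + seq n 1), (n + 1) * c * seq n 4]) (hc : c ≠ 0)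
    (n : ℕ) :
    ((seq n 0 : ℂ) + (seq n 1 : ℂ) * Complex.I = ((a : ℂ) + (b : ℂ) * Complex.I) ^ n) ∧
    ((seq n 4 : ℂ) = (n.factorial : ℂ) * (c : ℂ) ^ n) ∧
    ((seq n 2 : ℂ) + (seq n 3 : ℂ) * Complex.I = (n.factorial : ℂ) * (c : ℂ) ^ n *
      ∑ k ∈ Finset.range n, (((a : ℂ) + (b : ℂ) * Complex.I) / (c : ℂ)) ^ k / (k.factorial : ℂ)) := by
  have hc' : (c : ℂ) ≠ 0 := by exact_mod_cast hc
  induction n with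
  | zero => simp [h0]
  | succ n ih =>
    obtain ⟨hP, hD, hT⟩ := ih
    have e0 : seq (n + 1) 0 = a * seq n 0 - b * seq n 1 := by rw [hS]; simp
    have e1 : seq (n + 1) 1 = a * seq n 1 + b * seq n 0 := by rw [hS]; simp
    have e2 : seq (n + 1) 2 = (n + 1) * c * (seq n 2 + seq n 0) := by rw [hS]; simp
    have e3 : seq (n + 1) 3 = (n + 1) * c * (seq n 3 + seq n 1) := by rw [hS]; simp
    have e4 : seq (n + 1) 4 = (n + 1) * c * seq n 4 := by rw [hS]; simp
    have hn : (n.factorial : ℂ) ≠ 0 := by exact_mod_cast n.factorial_ne_zero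
    have hcn : (c : ℂ) ^ n ≠ 0 := pow_ne_zero _ hc'
    refine ⟨?_, ?_, ?_⟩
    · rw [e0, e1, pow_succ, ← hP]
      push_cast
      linear_combination (-(b : ℂ) * (seq n 1 : ℂ)) * Complex.I_mul_I
    · rw [e4]; push_cast; rw [hD, Nat.factorial_succ, pow_succ]; push_cast; ring
    · calc ((seq (n + 1) 2 : ℤ) : ℂ) + ((seq (n + 1) 3 : ℤ) : ℂ) * Complex.I
          = ((n : ℂ) + 1) * c * ((((seq n 2 : ℤ) : ℂ) + ((seq n 3 : ℤ) : ℂ) * Complex.I) +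
              (((seq n 0 : ℤ) : ℂ) + ((seq n 1 : ℤ) : ℂ) * Complex.I)) := by rw [e2, e3]; push_cast; ring
        _ = ((n : ℂ) + 1) * c * ((n.factorial : ℂ) * (c : ℂ) ^ n *
              (∑ k ∈ Finset.range n, (((a : ℂ) + (b : ℂ) * Complex.I) / (c : ℂ)) ^ k / (k.factorial : ℂ)) +
              ((a : ℂ) + (b : ℂ) * Complex.I) ^ n) := by rw [hT, hP]
        _ = ((n + 1).factorial : ℂ) * (c : ℂ) ^ (n + 1) *
              ∑ k ∈ Finset.range (n + 1), (((a : ℂ) + (b : ℂ) * Complex.I) / (c : ℂ)) ^ k / (k.factorial : ℂ) := by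
          rw [Finset.sum_range_succ, Nat.factorial_succ, pow_succ, div_pow]
          push_cast
          field_simp

/-- The partial sums `S_n(q) = Σ_{k<n} q^k/k!` converge to `exp q`. [folklore] -/
theorem tendsto_taylor_cexp (q : ℂ) :
    Tendsto (fun n : ℕ => ∑ k ∈ Finset.range n, q ^ k / (k.factorial : ℂ)) atTop (𝓝 (Complex.exp q)) := by
  have h := NormedSpace.expSeries_div_hasSum_exp (𝔸 := ℂ) q
  rw [← Complex.exp_eq_exp_ℂ] at h
  exact h.tendsto_sum_nat

variable [FirstOrder.Ring.CompatibleRing ℤ] {σ : Type*}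

/-! ## Gluing families along a definable partition -/

/-- A family that agrees with one ring-definable family on a ring-definable set of parameters and with another off it is
ring-definable. [folklore] -/
theorem defR_piecewise {D : Set (σ → ℤ)} (hD : (∅ : Set ℤ).Definable Language.ring D) {f g h : (σ → ℤ) → ℝ}
    (hg : (∅ : Set ℤ).Definable Language.ring {w : _ ⊕ Fin 2 → ℤ | 0 < w (Sum.inr 1) ∧ ((w (Sum.inr 0) : ℤ) : ℝ) < ((w (Sum.inr 1) : ℤ) : ℝ) * (g ∘ fun w' s => w' (Sum.inl s)) w}) (hh : (∅ : Set ℤ).Definable Language.ring {w : _ ⊕ Fin 2 → ℤ | 0 < w (Sum.inr 1) ∧ ((w (Sum.inr 0) : ℤ) : ℝ) < ((w (Sum.inr 1) : ℤ) : ℝ) * (h ∘ fun w' s => w' (Sum.inl s)) w}) (hfg : ∀ v ∈ D, f v = g v) (hfh : ∀ v ∉ D, f v = h v) : (∅ : Set ℤ).Definable Language.ring {w : _ ⊕ Fin 2 → ℤ | 0 < w (Sum.inr 1) ∧ ((w (Sum.inr 0) : ℤ) : ℝ) < ((w (Sum.inr 1) : ℤ) : ℝ) * (f ∘ fun w' s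 => w' (Sum.inl s)) w} := by
  have hD' : (∅ : Set ℤ).Definable Language.ring {w : σ ⊕ Fin 2 → ℤ | (fun s => w (Sum.inl s)) ∈ D} :=
    hD.preimage_comp Sum.inl
  have h' := (hD'.inter hg).union (hD'.compl.inter hh)
  convert h' using 1
  ext w
  simp only [mem_setOf_eq, Function.comp_apply, mem_union, mem_inter_iff, mem_compl_iff]
  by_cases hw : (fun s => w (Sum.inl s)) ∈ D
  · rw [hfg _ hw]; simp [hw]
  · rw [hfh _ hw]; simp [hw]

/-! ## The Taylor partial sums are ring-definable functions of `(a, b, c, n)` -/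

/-- The base of the Taylor recursion is a ring-definable map. -/
theorem ringDefinableMap_taylorBase :
    (∅ : Set ℤ).DefinableMap Language.ring (fun _ : Fin 3 → ℤ => (![1, 0, 0, 0, 1] : Fin 5 → ℤ)) := by
  intro i
  fin_cases i
  · simpa using ringDefinableFun_intCast (α := Fin 3) 1
  · simpa using ringDefinableFun_intCast (α := Fin 3) 0
  · simpa using ringDefinableFun_intCast (α := Fin 3) 0
  · simpa using ringDefinableFun_intCast (α := Fin 3) 0
  · simpa using ringDefinableFun_intCast (α := Fin 3) 1

/-- The step of the Taylor recursion, read on `(a, b, c, n, y) ∈ ℤ³ × ℤ × ℤ⁵`, is a ring-definable map (ring terms). -/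
theorem ringDefinableMap_taylorStep :
    (∅ : Set ℤ).DefinableMap Language.ring (fun w : (Fin 3 ⊕ Unit) ⊕ Fin 5 → ℤ =>
      (fun (t : Fin 3 → ℤ) (n : ℤ) (y : Fin 5 → ℤ) => (![t 0 * y 0 - t 1 * y 1, t 0 * y 1 + t 1 * y 0,
        (n + 1) * t 2 * (y 2 + y 0), (n + 1) * t 2 * (y 3 + y 1), (n + 1) * t 2 * y 4] : Fin 5 → ℤ))
      (fun s => w (Sum.inl (Sum.inl s))) (w (Sum.inl (Sum.inr ()))) (fun i => w (Sum.inr i))) := by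
  have p : ∀ j : (Fin 3 ⊕ Unit) ⊕ Fin 5, (∅ : Set ℤ).DefinableFun Language.ring
      (fun w : (Fin 3 ⊕ Unit) ⊕ Fin 5 → ℤ => w j) := fun j => definableFun_proj_params j
  intro i
  fin_cases i
  · simpa using ringDefinableFun_sub (ringDefinableFun_mul (p (Sum.inl (Sum.inl 0))) (p (Sum.inr 0)))
      (ringDefinableFun_mul (p (Sum.inl (Sum.inl 1))) (p (Sum.inr 1)))
  · simpa using ringDefinableFun_add (ringDefinableFun_mul (p (Sum.inl (Sum.inl 0))) (p (Sum.inr 1)))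
      (ringDefinableFun_mul (p (Sum.inl (Sum.inl 1))) (p (Sum.inr 0)))
  · simpa using ringDefinableFun_mul (ringDefinableFun_mul (ringDefinableFun_add (p (Sum.inl (Sum.inr ())))
      ringDefinableFun_one) (p (Sum.inl (Sum.inl 2)))) (ringDefinableFun_add (p (Sum.inr 2)) (p (Sum.inr 0)))
  · simpa using ringDefinableFun_mul (ringDefinableFun_mul (ringDefinableFun_add (p (Sum.inl (Sum.inr ())))
      ringDefinableFun_one) (p (Sum.inl (Sum.inl 2)))) (ringDefinableFun_add (p (Sum.inr 3)) (p (Sum.inr 1)))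
  · simpa using ringDefinableFun_mul (ringDefinableFun_mul (ringDefinableFun_add (p (Sum.inl (Sum.inr ())))
      ringDefinableFun_one) (p (Sum.inl (Sum.inl 2)))) (p (Sum.inr 4))

/-- **The real and imaginary parts of the Taylor partial sums `S_n((a+bi)/c)` are ring-definable families of `(a, b, c, n)`**
(`n` read through `Int.toNat`). [folklore] -/
theorem defC_taylorSum :
    ((∅ : Set ℤ).Definable Language.ring {w : _ ⊕ Fin 2 → ℤ | 0 < w (Sum.inr 1) ∧ ((w (Sum.inr 0) : ℤ) : ℝ) < ((w (Sum.inr 1) : ℤ) : ℝ) * ((Complex.re ∘ (fun w : Fin 3 ⊕ Unit → ℤ => ∑ k ∈ Finset.range (w (Sum.inr ())).toNat,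
      ((((w (Sum.inl 0) : ℤ) : ℂ) + ((w (Sum.inl 1) : ℤ) : ℂ) * Complex.I) / ((w (Sum.inl 2) : ℤ) : ℂ)) ^ k /
        (k.factorial : ℂ))) ∘ fun w' s => w' (Sum.inl s)) w} ∧ (∅ : Set ℤ).Definable Language.ring {w : _ ⊕ Fin 2 → ℤ | 0 < w (Sum.inr 1) ∧ ((w (Sum.inr 0) : ℤ) : ℝ) < ((w (Sum.inr 1) : ℤ) : ℝ) * ((Complex.im ∘ (fun w : Fin 3 ⊕ Unit → ℤ => ∑ k ∈ Finset.range (w (Sum.inr ())).toNat,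
      ((((w (Sum.inl 0) : ℤ) : ℂ) + ((w (Sum.inl 1) : ℤ) : ℂ) * Complex.I) / ((w (Sum.inl 2) : ℤ) : ℂ)) ^ k /
        (k.factorial : ℂ))) ∘ fun w' s => w' (Sum.inl s)) w}) := by
  -- the recursion as a function
  set step : (Fin 3 → ℤ) → ℤ → (Fin 5 → ℤ) → Fin 5 → ℤ := fun t n y => ![t 0 * y 0 - t 1 * y 1, t 0 * y 1 + t 1 * y 0,
    (n + 1) * t 2 * (y 2 + y 0), (n + 1) * t 2 * (y 3 + y 1), (n + 1) * t 2 * y 4] with hstep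
  set seq : (Fin 3 → ℤ) → ℕ → Fin 5 → ℤ := fun t n =>
    Nat.rec (motive := fun _ => Fin 5 → ℤ) ![1, 0, 0, 0, 1] (fun k y => step t k y) n with hseq
  have h0 : ∀ t, seq t 0 = ![1, 0, 0, 0, 1] := fun t => rfl
  have hS : ∀ t n, seq t (n + 1) = step t n (seq t n) := fun t n => rfl
  have hmap := ringDefinableMap_natRec h0 hS ringDefinableMap_taylorBase ringDefinableMap_taylorStep
  -- the invariants at `t`
  have hinv : ∀ (t : Fin 3 → ℤ), t 2 ≠ 0 → ∀ n : ℕ,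
      ((seq t n 4 : ℂ) = (n.factorial : ℂ) * ((t 2 : ℤ) : ℂ) ^ n) ∧
      ((seq t n 2 : ℂ) + (seq t n 3 : ℂ) * Complex.I = (n.factorial : ℂ) * ((t 2 : ℤ) : ℂ) ^ n *
        ∑ k ∈ Finset.range n, ((((t 0 : ℤ) : ℂ) + ((t 1 : ℤ) : ℂ) * Complex.I) / ((t 2 : ℤ) : ℂ)) ^ k /
          (k.factorial : ℂ)) := by
    intro t ht n
    have := taylor_invariant (t 0) (t 1) (t 2) (seq t) (h0 t) (fun n => by rw [hS]) ht n
    exact ⟨this.2.1, this.2.2⟩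
  -- the sum as `T_n / D_n` for `c ≠ 0`
  have hsum : ∀ (t : Fin 3 → ℤ), t 2 ≠ 0 → ∀ n : ℕ,
      (∑ k ∈ Finset.range n, ((((t 0 : ℤ) : ℂ) + ((t 1 : ℤ) : ℂ) * Complex.I) / ((t 2 : ℤ) : ℂ)) ^ k /
        (k.factorial : ℂ)) = ((seq t n 2 : ℂ) + (seq t n 3 : ℂ) * Complex.I) / ((seq t n 4 : ℤ) : ℝ) := by
    intro t ht n
    obtain ⟨hD, hT⟩ := hinv t ht n
    have hD0 : (seq t n 4 : ℂ) ≠ 0 := by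
      rw [hD]; exact mul_ne_zero (by exact_mod_cast (Nat.factorial_ne_zero n)) (pow_ne_zero _ (by exact_mod_cast ht))
    have hD0' : (n.factorial : ℂ) * ((t 2 : ℤ) : ℂ) ^ n ≠ 0 := hD ▸ hD0
    rw [Complex.ofReal_intCast, hT, hD, mul_div_cancel_left₀ _ hD0']
  -- the value at `c = 0`: `S_0 = 0`, `S_n = 1` for `n ≥ 1`
  have hzero : ∀ (t : Fin 3 → ℤ), t 2 = 0 → ∀ n : ℕ,
      (∑ k ∈ Finset.range n, ((((t 0 : ℤ) : ℂ) + ((t 1 : ℤ) : ℂ) * Complex.I) / ((t 2 : ℤ) : ℂ)) ^ k /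
        (k.factorial : ℂ)) = if n = 0 then 0 else 1 := by
    intro t ht n
    rw [ht, Int.cast_zero, div_zero]
    cases n with
    | zero => simp
    | succ n =>
      rw [Finset.sum_range_succ']
      simp
  -- definability: piecewise along `c = 0`, and along `n ≤ 0` on the degenerate piece
  have hDc : (∅ : Set ℤ).Definable Language.ring {w : Fin 3 ⊕ Unit → ℤ | w (Sum.inl 2) ≠ 0} :=
    ringDefinable_setOf_ne (definableFun_proj_params _) ringDefinableFun_zero
  have hDn : (∅ : Set ℤ).Definable Language.ring {w : Fin 3 ⊕ Unit → ℤ | w (Sum.inr ()) ≤ 0} :=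
    ringDefinable_setOf_le (definableFun_proj_params _) ringDefinableFun_zero
  have hdeg : (∅ : Set ℤ).Definable Language.ring {w : _ ⊕ Fin 2 → ℤ | 0 < w (Sum.inr 1) ∧ ((w (Sum.inr 0) : ℤ) : ℝ) < ((w (Sum.inr 1) : ℤ) : ℝ) * ((fun w : Fin 3 ⊕ Unit → ℤ => if (w (Sum.inr ())).toNat = 0 then (0 : ℝ) else 1) ∘ fun w' s => w' (Sum.inl s)) w} := by
    refine defR_piecewise hDn (defR_intCast ringDefinableFun_zero) (defR_intCast ringDefinableFun_one)
      (fun v hv => ?_) (fun v hv => ?_)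
    · simp only [mem_setOf_eq] at hv
      rw [if_pos (Int.toNat_of_nonpos hv)]; simp
    · simp only [mem_setOf_eq, not_le] at hv
      rw [if_neg (by omega)]; simp
  refine ⟨?_, ?_⟩
  · refine defR_piecewise hDc (defR_ratio (hmap 2) (hmap 4)) hdeg (fun w hw => ?_) (fun w hw => ?_)
    · simp only [mem_setOf_eq] at hw
      simp only [Function.comp_apply]
      rw [hsum (fun s => w (Sum.inl s)) hw, Complex.div_ofReal_re]
      simp
    · simp only [mem_setOf_eq, not_not] at hw
      simp only [Function.comp_apply]
      rw [hzero (fun s => w (Sum.inl s)) hw]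
      split_ifs <;> simp
  · refine defR_piecewise hDc (defR_ratio (hmap 3) (hmap 4)) (defR_intCast ringDefinableFun_zero)
      (fun w hw => ?_) (fun w hw => ?_)
    · simp only [mem_setOf_eq] at hw
      simp only [Function.comp_apply]
      rw [hsum (fun s => w (Sum.inl s)) hw, Complex.div_ofReal_im]
      simp
    · simp only [mem_setOf_eq, not_not] at hw
      simp only [Function.comp_apply]
      rw [hzero (fun s => w (Sum.inl s)) hw]
      split_ifs <;> simp

/-! ## The exponential at Gaussian rationals -/

/-- **`(a, b, c) ↦ exp((a + bi)/c)` is a ring-definable complex family** (limit of the ring-definable Taylor partial sums).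
[folklore] -/
theorem defC_cexp_testPoint :
    ((∅ : Set ℤ).Definable Language.ring {w : _ ⊕ Fin 2 → ℤ | 0 < w (Sum.inr 1) ∧ ((w (Sum.inr 0) : ℤ) : ℝ) < ((w (Sum.inr 1) : ℤ) : ℝ) * ((Complex.re ∘ (fun t : Fin 3 → ℤ => Complex.exp ((((t 0 : ℤ) : ℂ) + ((t 1 : ℤ) : ℂ) * Complex.I) / ((t 2 : ℤ) : ℂ)))) ∘ fun w' s => w' (Sum.inl s)) w} ∧ (∅ : Set ℤ).Definable Language.ring {w : _ ⊕ Fin 2 → ℤ | 0 < w (Sum.inr 1) ∧ ((w (Sum.inr 0) : ℤ) : ℝ) < ((w (Sum.inr 1) : ℤ) : ℝ) * ((Complex.im ∘ (fun t : Fin 3 → ℤ => Complex.exp ((((t 0 : ℤ) : ℂ) + ((t 1 : ℤ) : ℂ) * Complex.I) / ((t 2 : ℤ) : ℂ)))) ∘ fun w' s => w' (Sum.inl s)) w}) := by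
  obtain ⟨hre, him⟩ := defC_taylorSum
  refine ⟨defR_limit hre fun t => ?_, defR_limit him fun t => ?_⟩
  · have h := (Complex.continuous_re.tendsto _).comp
      (tendsto_taylor_cexp ((((t 0 : ℤ) : ℂ) + ((t 1 : ℤ) : ℂ) * Complex.I) / ((t 2 : ℤ) : ℂ)))
    simpa [Function.comp_def] using h
  · have h := (Complex.continuous_im.tendsto _).comp
      (tendsto_taylor_cexp ((((t 0 : ℤ) : ℂ) + ((t 1 : ℤ) : ℂ) * Complex.I) / ((t 2 : ℤ) : ℂ)))
    simpa [Function.comp_def] using h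

/-- `v ↦ exp((A v + B v i)/C v)` is a ring-definable complex family for ring-definable integer functions `A, B, C` of a finite
tuple of parameters. [folklore] -/
theorem defC_cexp_gaussRat [Finite σ] {A B C : (σ → ℤ) → ℤ} (hA : (∅ : Set ℤ).DefinableFun Language.ring A)
    (hB : (∅ : Set ℤ).DefinableFun Language.ring B) (hC : (∅ : Set ℤ).DefinableFun Language.ring C) :
    ((∅ : Set ℤ).Definable Language.ring {w : _ ⊕ Fin 2 → ℤ | 0 < w (Sum.inr 1) ∧ ((w (Sum.inr 0) : ℤ) : ℝ) < ((w (Sum.inr 1) : ℤ) : ℝ) * ((Complex.re ∘ (fun v => Complex.exp ((((A v : ℤ) : ℂ) + ((B v : ℤ) : ℂ) * Complex.I) / ((C v : ℤ) : ℂ)))) ∘ fun w' s => w' (Sum.inl s)) w} ∧ (∅ : Set ℤ).Definable Language.ring {w : _ ⊕ Fin 2 → ℤ | 0 < w (Sum.inr 1) ∧ ((w (Sum.inr 0) : ℤ) : ℝ) < ((w (Sum.inr 1) : ℤ) : ℝ) * ((Complex.im ∘ (fun v => Complex.exp ((((A v : ℤ) : ℂ) + ((B v : ℤ) : ℂ)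 * Complex.I) / ((C v : ℤ) : ℂ)))) ∘ fun w' s => w' (Sum.inl s)) w}) := by
  have hF : (∅ : Set ℤ).DefinableMap Language.ring (fun v : σ → ℤ => (![A v, B v, C v] : Fin 3 → ℤ)) := by
    intro i; fin_cases i
    · simpa using hA
    · simpa using hB
    · simpa using hC
  obtain ⟨hre, him⟩ := defC_cexp_testPoint
  have h1 := hre.preimage_map (F := fun u : σ ⊕ Fin 2 → ℤ =>
    (Sum.elim (![A (fun s => u (Sum.inl s)), B (fun s => u (Sum.inl s)), C (fun s => u (Sum.inl s))])
      (fun i => u (Sum.inr i)) : Fin 3 ⊕ Fin 2 → ℤ)) ?_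
  · have h2 := him.preimage_map (F := fun u : σ ⊕ Fin 2 → ℤ =>
      (Sum.elim (![A (fun s => u (Sum.inl s)), B (fun s => u (Sum.inl s)), C (fun s => u (Sum.inl s))])
        (fun i => u (Sum.inr i)) : Fin 3 ⊕ Fin 2 → ℤ)) ?_
    · constructor
      · convert h1 using 1
        ext u; simp
      · convert h2 using 1
        ext u; simp
    · rintro (i | j)
      · simpa using definableFun_reindex (hF i) (Sum.inl : σ → σ ⊕ Fin 2)
      · exact definableFun_proj_params (L := Language.ring) (A := (∅ : Set ℤ)) (α := σ ⊕ Fin 2) (Sum.inr j)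
  · rintro (i | j)
    · simpa using definableFun_reindex (hF i) (Sum.inl : σ → σ ⊕ Fin 2)
    · exact definableFun_proj_params (L := Language.ring) (A := (∅ : Set ℤ)) (α := σ ⊕ Fin 2) (Sum.inr j)

/-! ## Registered form -/

omit [FirstOrder.Ring.CompatibleRing ℤ] in
/-- Registered helper stub `ringDefinable_reCut_cexp_gaussRat` of crux stmt-Schanuel-0969 (line kernel-arithmetic-selection, S8‴):
**the exponential function is arithmetical on `ℚ[i]`** — the set `{(a, b, c, p, r) ∈ ℤ⁵ : 0 < r ∧ p/r < Re exp((a+bi)/c)}` is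
`∅`-definable in the ring `ℤ` (Taylor partial sums by ring-definable primitive recursion + limits; Weihrauch 2000, Thm 4.3.2 in
arithmetical form). [folklore] -/
theorem ringDefinable_reCut_cexp_gaussRat : ∀ [FirstOrder.Ring.CompatibleRing ℤ], (∅ : Set ℤ).Definable FirstOrder.Language.ring {w : Fin 3 ⊕ Fin 2 → ℤ | 0 < w (Sum.inr 1) ∧ ((w (Sum.inr 0) : ℤ) : ℝ) < ((w (Sum.inr 1) : ℤ) : ℝ) * (Complex.exp ((((w (Sum.inl 0) : ℤ) : ℂ) + ((w (Sum.inl 1) : ℤ) : ℂ) * Complex.I) / ((w (Sum.inl 2) : ℤ) : ℂ))).re} := by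
  intro _
  exact defC_cexp_testPoint.1

end Summit.Schanuel.Schanuel.Cruxes.MinimalCounterexampleInAcl.KernelArithmeticSelection
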